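import Mathlib.GroupTheory.Nilpotent
import Mathlib.GroupTheory.Commutator.Basic
import Mathlib.GroupTheory.QuotientGroup.Basic
import Mathlib.Data.Fin.Tuple.Basic
import Mathlib.Algebra.Group.Pi.Basic
import Mathlib.Algebra.BigOperators.Fin
import Mathlib.Tactic.Group
import HarnessLib

/-!
# Linear equations in primes: Host–Kra cube groups and the corner constraint (Green–Tao 2010, App. E)

Trunk T-SIEVE (`Literature/NumberTheory/Sieve`), part of the inline decomposition of the named
fact `Literature.NumberTheory.Sieve.GreenTao2010_gowersUniformity` (B. Green, T. Tao, *Linear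
equations in primes*, Ann. of Math. 171 (2010), Thm. 7.2). After
`LinearEquationsInPrimesGowersU2.lean` (Thm. 7.2 at level `s = 1`, unconditional) what is left of
Thm. 7.2 is the level `s ≥ 2` theory: the inverse theorem `GI(s)`, the Möbius–nilsequences
theorem `MN(s)`, and §11 of the paper — "nilsequences obstruct uniformity" (Cor. 11.6,
`GreenTao2010_nilObstructionAt`) and the decomposition of nilsequences into averaged ones
(Prop. 11.2), both resting on the *parallelepiped constraint* Prop. 11.5, which the paper proves in
Appendix E through the algebraic theory of the **Host–Kra cube groups** `HK^{s+1}(G_•)`. This file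
vendors that algebraic theory, fully proved and in Mathlib generality (an arbitrary group with a
filtration; the paper works with the lower central series of a connected Lie group but remarks
that "the Host–Kra cube group could be defined with a more general filtration in place of the
lower central series", which is what Green–Tao–Ziegler 2012 need):

* `HostKra.IsFiltration G_•` — `G_•` antitone with `⁅G_i, G_j⁆ ≤ G_{i+j}`; `HostKra.lcs G` —
  Green–Tao's lower central series `G_0 = G_1 = G`, `G_{i+1} = ⁅G, G_i⁆` (Mathlib's
  `lowerCentralSeries ⊤` shifted by one), a filtration (`isFiltration_lcs`, via
  `⁅γ_a, γ_b⁆ ≤ γ_{a+b+1}`, `commutator_lowerCentralSeries_le`, proved from Mathlib's Three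
  Subgroups Lemma transported to a quotient, `commutator_commutator_le_of_rotate`);
* App. E, Def. E.1–E.3 (corpus: "Simple combinatorics of `{0,1}^{s+1}`", "Face groups", "Host–Kra
  cube group"): vertices `HostKra.Vertex k = (Fin k → Bool)`, faces as partial assignments
  `HostKra.Face k = (Fin k → Option Bool)` (`Face.Mem`, `Face.codim`), the face elements `g^F`
  (`HostKra.faceElt`) and `HostKra.HK k G_•`, the subgroup of `G^{{0,1}^k}` generated by the
  `g^F`, `g ∈ G_{codim F}`, `F` ranging over ALL faces (as printed);
* Lemma E.4 ("Parallelepipeds are Host–Kra cubes"): `(g^{n + ω·h} x)_ω ∈ HK^k(G_•)` for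
  `g ∈ G_1`, `x ∈ G_0`, `n ∈ ℤ`, `h ∈ ℤ^k` (`parallelepiped_mem_HK`, and `…_nat`, `…_lcs`);
* Lemma E.5 (ii) ("Face relations"): `⁅g^F, h^{F'}⁆ = ⁅g, h⁆^{F ∩ F'}`
  (`commutatorElement_faceElt_of_compatible`, `codim_merge_le`);
* the recursive structure `HK^{k+1}(G_•) = {(c, c·d) : c ∈ HK^k(G_•), d ∈ HK^k(G_•^{+1})}`
  (`mem_HK_succ_iff`, with `G_•^{+1} = (G_{i+1})_i`, `HostKra.shift`), including
  "`HK^k(G_•)` normalises `HK^k(G_•^{+1})`" (`conj_mem_shift`);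
* Lemma E.7 (corpus Lemma 60: "Suppose that `g = (g_ω) ∈ HK^{s+1}(G_•)` and that `g_ω ∈ Γ` for
  all `ω ∈ {0,1}^{s+1}_*`. Then the remaining point `g_{0^{s+1}}` lies in `Γ` as well.") for an
  ARBITRARY subgroup `Γ` and any filtration with `G_k = {1}` (`apply_bot_mem`, `apply_top_mem`,
  `apply_bot_mem_of_nilpotent`), whence the uniqueness of the corner vertex
  (`eq_of_forall_ne_bot_eq`, the algebraic content of Prop. 11.5: "the value of any one vertex of a
  parallelepiped … is determined … by all the other vertices") and its form modulo `Γ`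
  (`quotient_apply_bot_eq`), which is the injectivity statement used in the proof of Prop. 11.5.

## Design

* **The recursion instead of the ordered factorisation.** The paper obtains Lemma E.7 from the
  factorisation `HK^{s+1}(G_•) = Γ_{F_1} ⋯ Γ_{F_{2^{s+1}}}` along a decreasing ordering of the
  lower faces ((E.1) there) and the observation that `τ_i(g)` is a word in the coordinates
  `g_{max F_1}, …, g_{max F_i}`. We prove the same consequences from the equivalent recursive
  description of `HK^{k+1}` by halves along the first coordinate (`mem_HK_succ_iff`): the lower
  half `ω_0 = 0` of `c ∈ HK^{k+1}(G_•)` lies in `HK^k(G_•)` and the "discrete derivative"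
  `(c|_{ω_0=0})⁻¹ c|_{ω_0=1}` lies in `HK^k` of the shifted filtration; conversely such pairs
  assemble to elements of `HK^{k+1}`. (Generators split into the three kinds of faces
  `F × {0,1}`, `F × {0}`, `F × {1}`; closure under products is "`HK^k(G_•)` normalises
  `HK^k(G_•^{+1})`", which is Lemma E.5 (ii) plus `⁅G_i, G_{j+1}⁆ ≤ G_{i+j+1}`.) Lemma E.7 then
  follows by induction on `k`, the shifted filtration of an `s`-step one being `(s-1)`-step, and
  so does Lemma E.4. The same recursion will give the cocompactness Lemma E.10 in the sequel.
* Vertices are Boolean vectors rather than subsets of `[k]` (the Gowers-norm files of this series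
  index `{0,1}^k` by `Finset (Fin k)`); the dictionary `ω ↦ {i : ω_i = 1}` is only needed when
  cubes meet Gowers norms (the sequel). `ω · h = ∑_i ω_i h_i` is `HostKra.dot`.
* Everything is stated for the corner `1^k` (natural for the recursion) and transported to the
  printed corner `0^k` by the reflection `ω ↦ 1^k - ω`, which preserves `HK^k(G_•)`
  (`reflect_mem_HK_iff`).
* Not here (sequel files): the topology — Lemma E.9 (Mal'cev: `Γ ∩ G_j` cocompact in `G_j`),
  Lemma E.10, the Host–Kra nilmanifold and Prop. 11.5 proper (`Σ` compact, `P` continuous) — and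
  §11 (Prop. 11.2, Cor. 11.6).

## References

* B. Green, T. Tao, *Linear equations in primes*, Ann. of Math. (2) 171 (2010), 1753–1850
  (arXiv:math/0606088), Appendix E "Nilmanifold constraints; Host–Kra cube groups": Def. E.1–E.3,
  Lemma E.4, Lemma E.5, the factorisation (E.1), Lemma E.7; §11, Prop. 11.5.
* B. Host, B. Kra, *Nonconventional ergodic averages and nilmanifolds*, Ann. of Math. (2) 161
  (2005), 397–488 (the origin of the cube groups; not used directly).
-/

namespace Literature.NumberTheory.Sieve.HostKra

open Finset
open scoped commutatorElement

variable {G : Type*} [Group G]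

/-! ### Filtrations and the lower central series -/

/-- A **filtration** `G_• = (G_i)_{i ∈ ℕ}` on a group: a decreasing sequence of subgroups with
`⁅G_i, G_j⁆ ≤ G_{i+j}` ("a sequence of subgroups in which the condition that `G_{i+1} = [G, G_i]`
is relaxed to an inclusion `[G_i, G_j] ⊆ G_{i+j}`"). [cite: GreenTao2010, App. E, Remark after Def. E.3] -/
structure IsFiltration (G_ : ℕ → Subgroup G) : Prop where
  antitone : Antitone G_
  commutator_le : ∀ i j, ⁅G_ i, G_ j⁆ ≤ G_ (i + j)

/-- The shifted filtration `G_•^{+1} = (G_{i+1})_{i ∈ ℕ}`. [folklore] -/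
def shift (G_ : ℕ → Subgroup G) : ℕ → Subgroup G := fun i => G_ (i + 1)

/-- `G^{+1}_i = G_{i+1}`. [folklore] -/
@[simp] theorem shift_apply (G_ : ℕ → Subgroup G) (i : ℕ) : shift G_ i = G_ (i + 1) := rfl

/-- The shift of a filtration is a filtration (`⁅G_{i+1}, G_{j+1}⁆ ≤ G_{i+j+2} ≤ G_{i+j+1}`).
[folklore] -/
theorem IsFiltration.shift {G_ : ℕ → Subgroup G} (h : IsFiltration G_) :
    IsFiltration (shift G_) where
  antitone := fun i j hij => h.antitone (by omega)
  commutator_le := fun i j =>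
    (h.commutator_le (i + 1) (j + 1)).trans (h.antitone (by omega))

/-- In a filtration `G_0` normalises `G_1` (from `⁅G_0, G_1⁆ ≤ G_1`). [folklore] -/
theorem IsFiltration.conj_mem {G_ : ℕ → Subgroup G} (h : IsFiltration G_) {x y : G}
    (hx : x ∈ G_ 0) (hy : y ∈ G_ 1) : x * y * x⁻¹ ∈ G_ 1 := by
  have h1 : ⁅x, y⁆ ∈ G_ 1 := by
    have := h.commutator_le 0 1
    rw [zero_add] at this
    exact this (Subgroup.commutator_mem_commutator hx hy)
  have : ⁅x, y⁆ * y = x * y * x⁻¹ := by simp [commutatorElement_def]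
  rw [← this]
  exact (G_ 1).mul_mem h1 hy

/-- **The Three Subgroups Lemma relative to a normal subgroup**: if `⁅⁅H₂, H₃⁆, H₁⁆` and
`⁅⁅H₃, H₁⁆, H₂⁆` lie in the normal subgroup `N`, so does `⁅⁅H₁, H₂⁆, H₃⁆` (Mathlib has the case
`N = ⊥`, `Subgroup.commutator_commutator_eq_bot_of_rotate`; the general case is that one in `G/N`).
[folklore] -/
theorem commutator_commutator_le_of_rotate {H₁ H₂ H₃ N : Subgroup G} [N.Normal]
    (h1 : ⁅⁅H₂, H₃⁆, H₁⁆ ≤ N) (h2 : ⁅⁅H₃, H₁⁆, H₂⁆ ≤ N) : ⁅⁅H₁, H₂⁆, H₃⁆ ≤ N := by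
  have key : ∀ K : Subgroup G, K ≤ N ↔ K.map (QuotientGroup.mk' N) = ⊥ := by
    intro K
    rw [Subgroup.map_eq_bot_iff, QuotientGroup.ker_mk']
  rw [key, Subgroup.map_commutator, Subgroup.map_commutator] at h1 h2 ⊢
  exact Subgroup.commutator_commutator_eq_bot_of_rotate h1 h2

/-- `⁅γ_a(G), γ_b(G)⁆ ≤ γ_{a+b+1}(G)` for Mathlib's lower central series `γ_0 = G`,
`γ_{n+1} = ⁅γ_n, G⁆` ("We recall the standard facts that `[G_i, G_j] ⊆ G_{i+j}`"; induction on `b`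
with the Three Subgroups Lemma). [folklore] -/
theorem commutator_lowerCentralSeries_le (a b : ℕ) :
    ⁅(⊤ : Subgroup G).lowerCentralSeries a, (⊤ : Subgroup G).lowerCentralSeries b⁆ ≤
      (⊤ : Subgroup G).lowerCentralSeries (a + b + 1) := by
  induction b generalizing a with
  | zero => exact le_of_eq rfl
  | succ b ih =>
    rw [Subgroup.lowerCentralSeries_succ,
      Subgroup.commutator_comm ((⊤ : Subgroup G).lowerCentralSeries a)]
    apply commutator_commutator_le_of_rotate
    · rw [Subgroup.commutator_comm ⊤, ← Subgroup.lowerCentralSeries_succ]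
      have := ih (a + 1)
      rwa [show a + 1 + b + 1 = a + (b + 1) + 1 by omega] at this
    · calc ⁅⁅(⊤ : Subgroup G).lowerCentralSeries a, (⊤ : Subgroup G).lowerCentralSeries b⁆,
            (⊤ : Subgroup G)⁆
          ≤ ⁅(⊤ : Subgroup G).lowerCentralSeries (a + b + 1), (⊤ : Subgroup G)⁆ :=
            Subgroup.commutator_mono (ih a) le_rfl
        _ = (⊤ : Subgroup G).lowerCentralSeries (a + b + 1 + 1) := rfl
        _ = (⊤ : Subgroup G).lowerCentralSeries (a + (b + 1) + 1) := by
            rw [show a + b + 1 + 1 = a + (b + 1) + 1 by omega]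

/-- Green–Tao's lower central series `G_•`: "`G_0 = G_1 = G`, and `G_{i+1} = [G, G_i]`"
(Mathlib's `lowerCentralSeries ⊤`, shifted by one). [cite: GreenTao2010, Def. 8.1 and App. E] -/
def lcs (G : Type*) [Group G] (i : ℕ) : Subgroup G := (⊤ : Subgroup G).lowerCentralSeries (i - 1)

/-- `G_0 = G`. [cite: GreenTao2010, App. E] -/
theorem lcs_zero : lcs G 0 = ⊤ := rfl

/-- `G_1 = G`. [cite: GreenTao2010, App. E] -/
theorem lcs_one : lcs G 1 = ⊤ := rfl

/-- `G_{i+1} = γ_i(G)` in Mathlib's indexing. [folklore] -/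
theorem lcs_succ (i : ℕ) : lcs G (i + 1) = (⊤ : Subgroup G).lowerCentralSeries i := by
  simp [lcs]

/-- Each `G_i` is normal ("each `G_i` is a closed connected normal Lie subgroup of `G`"; only
normality is meant here). [cite: GreenTao2010, App. E] -/
instance lcs_normal (i : ℕ) : (lcs G i).Normal := by
  unfold lcs; infer_instance

/-- The lower central series is a filtration: `G_i` decreases and `[G_i, G_j] ⊆ G_{i+j}`.
[cite: GreenTao2010, App. E] -/
theorem isFiltration_lcs : IsFiltration (lcs G) where
  antitone := fun i j hij => Subgroup.lowerCentralSeries_antitone ⊤ (by omega)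
  commutator_le := by
    intro i j
    rcases i with _ | i
    · rw [zero_add]; exact Subgroup.commutator_le_right _ _
    rcases j with _ | j
    · exact Subgroup.commutator_le_left _ _
    rw [lcs_succ, lcs_succ, show i + 1 + (j + 1) = (i + j + 1) + 1 by omega, lcs_succ]
    exact commutator_lowerCentralSeries_le i j

/-! ### The cube `{0,1}^k`, its faces, face elements (Def. E.1, E.2) -/

/-- The vertices `ω = (ω_1, …, ω_k) ∈ {0,1}^k` of "the cube" (`false = 0`, `true = 1`).
[cite: GreenTao2010, App. E, Def. E.1] -/
abbrev Vertex (k : ℕ) := Fin k → Bool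

/-- The faces of `{0,1}^k`: "A *hyperplane* is any set of the form `H_{j,a} := {ω : ω_j = a}` … a
*face of codimension `d`* is any non-empty intersection `F` of `d` distinct hyperplanes", i.e. a
partial assignment: `σ j = some a` fixes `ω_j = a`, `σ j = none` leaves `ω_j` free (non-empty
intersections of distinct hyperplanes fix each coordinate at most once).
[cite: GreenTao2010, App. E, Def. E.1] -/
abbrev Face (k : ℕ) := Fin k → Option Bool

namespace Face

variable {k : ℕ}

/-- `ω ∈ F_σ`: `ω` takes the prescribed value at every fixed coordinate.
[cite: GreenTao2010, App. E, Def. E.1] -/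
def Mem (σ : Face k) (ω : Vertex k) : Prop := ∀ i, σ i = none ∨ σ i = some (ω i)

/-- Membership in a face is decidable. [folklore] -/
instance instDecidableMem (σ : Face k) (ω : Vertex k) : Decidable (σ.Mem ω) := by
  unfold Mem; infer_instance

/-- The codimension `codim(F)` of a face: the number of fixed coordinates.
[cite: GreenTao2010, App. E, Def. E.1] -/
def codim (σ : Face k) : ℕ := ∑ i, if σ i = none then 0 else 1

/-- Two faces are *compatible* when no coordinate is fixed to different values, i.e. when they
intersect. [folklore] -/
def Compatible (σ τ : Face k) : Prop := ∀ i a b, σ i = some a → τ i = some b → a = b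

/-- The intersection `F_σ ∩ F_τ` of two compatible faces, as a face. [folklore] -/
def merge (σ τ : Face k) : Face k := fun i => (σ i).or (τ i)

/-- `F_σ ∩ F_τ` is empty if `σ, τ` are incompatible and is the face `F_{σ ⊔ τ}` otherwise.
[folklore] -/
theorem mem_and_mem_iff (σ τ : Face k) (ω : Vertex k) :
    σ.Mem ω ∧ τ.Mem ω ↔ σ.Compatible τ ∧ (σ.merge τ).Mem ω := by
  constructor
  · rintro ⟨hσ, hτ⟩
    refine ⟨fun i a b ha hb => ?_, fun i => ?_⟩
    · rcases hσ i with h | h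
      · rw [ha] at h; exact absurd h (by simp)
      rcases hτ i with h' | h'
      · rw [hb] at h'; exact absurd h' (by simp)
      rw [ha] at h; rw [hb] at h'
      simp only [Option.some.injEq] at h h'
      rw [h, h']
    · simp only [merge]
      rcases hσ i with h | h
      · rw [h, Option.none_or]; exact hτ i
      · rw [h, Option.some_or]; exact Or.inr rfl
  · rintro ⟨hc, hm⟩
    refine ⟨fun i => ?_, fun i => ?_⟩
    · have hi := hm i
      simp only [merge] at hi
      cases hσi : σ i with
      | none => exact Or.inl rfl
      | some a =>
        rw [hσi, Option.some_or] at hi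
        exact hi
    · have hi := hm i
      simp only [merge] at hi
      cases hτi : τ i with
      | none => exact Or.inl rfl
      | some b =>
        cases hσi : σ i with
        | none => rw [hσi, Option.none_or, hτi] at hi; exact hi
        | some a =>
          rw [hσi, Option.some_or] at hi
          have hab := hc i a b hσi hτi
          rcases hi with hi | hi
          · exact absurd hi (by simp)
          · right; rw [← hab, hi]

/-- "`codim(F ∩ F') ≤ codim(F) + codim(F')`". [cite: GreenTao2010, App. E, proof of Lemma E.5] -/
theorem codim_merge_le (σ τ : Face k) : (σ.merge τ).codim ≤ σ.codim + τ.codim := by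
  unfold codim merge
  rw [← Finset.sum_add_distrib]
  refine Finset.sum_le_sum fun i _ => ?_
  cases σ i <;> cases τ i <;> simp

/-- Membership in a face of `{0,1}^{k+1}` split along the first coordinate. [folklore] -/
theorem mem_cons_iff (τ : Option Bool) (σ : Face k) (ω : Vertex (k + 1)) :
    Face.Mem (Fin.cons τ σ : Face (k + 1)) ω ↔ (τ = none ∨ τ = some (ω 0)) ∧ σ.Mem (Fin.tail ω) := by
  simp only [Face.Mem, Fin.forall_fin_succ, Fin.cons_zero, Fin.cons_succ]
  rfl

/-- Codimension of a face of `{0,1}^{k+1}` split along the first coordinate. [folklore] -/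
theorem codim_cons (τ : Option Bool) (σ : Face k) :
    Face.codim (Fin.cons τ σ : Face (k + 1)) = (if τ = none then 0 else 1) + σ.codim := by
  simp only [Face.codim, Fin.sum_univ_succ, Fin.cons_zero, Fin.cons_succ]

/-- The unique face of `{0,1}^0` has codimension `0`. [folklore] -/
theorem codim_zero (σ : Face 0) : σ.codim = 0 := by
  simp [Face.codim]

/-- The unique vertex of `{0,1}^0` lies in its unique face. [folklore] -/
theorem mem_of_zero (σ : Face 0) (ω : Vertex 0) : σ.Mem ω := fun i => i.elim0

/-- Reflecting a face through the centre of the cube does not change its codimension.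
[folklore] -/
theorem codim_map_not (σ : Face k) : Face.codim (fun i => (σ i).map (!·)) = σ.codim := by
  unfold Face.codim
  refine Finset.sum_congr rfl fun i _ => ?_
  cases h : σ i <;> simp [h]

end Face

variable {k : ℕ}

/-- The **face element** `g^F ∈ G^{{0,1}^k}`: "`(g^F)_ω = g` when `ω ∈ F`, and `(g^F)_ω = id_G`
otherwise". [cite: GreenTao2010, App. E, Def. E.2] -/
def faceElt (σ : Face k) (g : G) : Vertex k → G := fun ω => if σ.Mem ω then g else 1

/-- `(g^F)_ω`. [cite: GreenTao2010, App. E, Def. E.2] -/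
theorem faceElt_apply (σ : Face k) (g : G) (ω : Vertex k) :
    faceElt σ g ω = if σ.Mem ω then g else 1 := rfl

/-- `1^F = 1`. [folklore] -/
@[simp] theorem faceElt_one (σ : Face k) : faceElt σ (1 : G) = 1 := by
  funext ω; simp [faceElt]

/-- `g^F h^F = (gh)^F` (so `Γ_F ≅ G_{codim F}`). [cite: GreenTao2010, App. E, Def. E.2] -/
theorem faceElt_mul (σ : Face k) (g h : G) : faceElt σ g * faceElt σ h = faceElt σ (g * h) := by
  funext ω; simp only [Pi.mul_apply, faceElt]; split_ifs <;> simp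

/-- `(g^F)⁻¹ = (g⁻¹)^F`. [folklore] -/
theorem faceElt_inv (σ : Face k) (g : G) : (faceElt σ g)⁻¹ = faceElt σ g⁻¹ := by
  funext ω; simp only [Pi.inv_apply, faceElt]; split_ifs <;> simp

/-- **Face relations, (ii), pointwise**: the commutator of `g^F` and `h^{F'}` is `⁅g, h⁆` on
`F ∩ F'` and trivial elsewhere (in particular `g^F`, `h^{F'}` commute for disjoint faces, (i)).
[cite: GreenTao2010, App. E, Lemma E.5] -/
theorem commutatorElement_faceElt (σ τ : Face k) (g h : G) :
    ⁅faceElt σ g, faceElt τ h⁆ = fun ω => if σ.Mem ω ∧ τ.Mem ω then ⁅g, h⁆ else 1 := by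
  funext ω
  simp only [commutatorElement_def, Pi.mul_apply, Pi.inv_apply, faceElt]
  by_cases hσ : σ.Mem ω <;> by_cases hτ : τ.Mem ω <;> simp [hσ, hτ]

/-- **Face relations, (ii)**: "any element of `[Γ_F, Γ_{F'}]` has the form `x^{F ∩ F'}` for some
`x ∈ [G_d, G_{d'}]`" — precisely `⁅g^F, h^{F'}⁆ = ⁅g, h⁆^{F ∩ F'}` for intersecting faces.
[cite: GreenTao2010, App. E, Lemma E.5] -/
theorem commutatorElement_faceElt_of_compatible {σ τ : Face k} (hc : σ.Compatible τ) (g h : G) :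
    ⁅faceElt σ g, faceElt τ h⁆ = faceElt (σ.merge τ) ⁅g, h⁆ := by
  rw [commutatorElement_faceElt]
  funext ω
  simp only [faceElt, Face.mem_and_mem_iff, hc, true_and]

/-- **Face relations, (i)**: face elements over disjoint faces commute.
[cite: GreenTao2010, App. E, Lemma E.5] -/
theorem commutatorElement_faceElt_of_not_compatible {σ τ : Face k} (hc : ¬ σ.Compatible τ)
    (g h : G) : ⁅faceElt σ g, faceElt τ h⁆ = 1 := by
  rw [commutatorElement_faceElt]
  funext ω
  simp only [Face.mem_and_mem_iff, hc, false_and, if_false, Pi.one_apply]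

/-! ### The Host–Kra cube group (Def. E.3) -/

/-- The generators of the Host–Kra cube group: the face elements `g^F` with `g ∈ G_{codim(F)}`,
`F` any face (the union of the "face groups `Γ_F`"). [cite: GreenTao2010, App. E, Def. E.2–E.3] -/
def hkGen (k : ℕ) (G_ : ℕ → Subgroup G) : Set (Vertex k → G) :=
  {x | ∃ σ : Face k, ∃ g ∈ G_ σ.codim, faceElt σ g = x}

/-- **The Host–Kra cube group** `HK^k(G_•)`: "the subgroup of `G^{{0,1}^{s+1}}` generated by all
the face groups `Γ_F`, as `F` ranges over faces of `{0,1}^{s+1}`" (here for any dimension `k` and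
any filtration `G_•`). [cite: GreenTao2010, App. E, Def. E.3] -/
def HK (k : ℕ) (G_ : ℕ → Subgroup G) : Subgroup (Vertex k → G) := Subgroup.closure (hkGen k G_)

/-- `g^F ∈ HK^k(G_•)` for `g ∈ G_{codim F}`. [cite: GreenTao2010, App. E, Def. E.3] -/
theorem faceElt_mem_HK {G_ : ℕ → Subgroup G} (σ : Face k) {g : G} (hg : g ∈ G_ σ.codim) :
    faceElt σ g ∈ HK k G_ :=
  Subgroup.subset_closure ⟨σ, g, hg, rfl⟩

/-- `⁅g^F, h^{F'}⁆ ∈ HK^k(G'_•)` as soon as `⁅g, h⁆ ∈ G'_{codim(F ∩ F')}` (or the faces are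
disjoint). [cite: GreenTao2010, App. E, Lemma E.5] -/
theorem commutatorElement_faceElt_mem {G_ : ℕ → Subgroup G} (σ τ : Face k) {g h : G}
    (hgh : ⁅g, h⁆ ∈ G_ (σ.merge τ).codim) : ⁅faceElt σ g, faceElt τ h⁆ ∈ HK k G_ := by
  by_cases hc : σ.Compatible τ
  · rw [commutatorElement_faceElt_of_compatible hc]; exact faceElt_mem_HK _ hgh
  · rw [commutatorElement_faceElt_of_not_compatible hc]; exact one_mem _

/-- A generator `g^F` of `HK^k(G_•)` conjugates `HK^k(G_•^{+1})` into itself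
(`g^F h^{F'} (g^F)⁻¹ = ⁅g, h⁆^{F ∩ F'} h^{F'}` with `⁅g, h⁆ ∈ G_{codim F + codim F' + 1}`).
[cite: GreenTao2010, App. E, Lemma E.5] -/
theorem faceElt_conj_mem_shift {G_ : ℕ → Subgroup G} (hG : IsFiltration G_) (σ : Face k) {g : G}
    (hg : g ∈ G_ σ.codim) {d : Vertex k → G} (hd : d ∈ HK k (shift G_)) :
    faceElt σ g * d * (faceElt σ g)⁻¹ ∈ HK k (shift G_) := by
  induction hd using Subgroup.closure_induction with
  | mem x hx =>
    obtain ⟨τ, h, hh, rfl⟩ := hx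
    have e : faceElt σ g * faceElt τ h * (faceElt σ g)⁻¹ =
        ⁅faceElt σ g, faceElt τ h⁆ * faceElt τ h := by
      simp only [commutatorElement_def, inv_mul_cancel_right]
    rw [e]
    refine mul_mem (commutatorElement_faceElt_mem σ τ ?_) (faceElt_mem_HK τ hh)
    simp only [shift_apply] at hh ⊢
    have h1 := hG.commutator_le _ _ (Subgroup.commutator_mem_commutator hg hh)
    have h2 := Face.codim_merge_le σ τ
    exact hG.antitone (by omega) h1
  | one => simp
  | mul x y _ _ hx hy =>
    have e : faceElt σ g * (x * y) * (faceElt σ g)⁻¹ =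
        (faceElt σ g * x * (faceElt σ g)⁻¹) * (faceElt σ g * y * (faceElt σ g)⁻¹) := by group
    rw [e]; exact mul_mem hx hy
  | inv x _ hx =>
    have e : faceElt σ g * x⁻¹ * (faceElt σ g)⁻¹ = (faceElt σ g * x * (faceElt σ g)⁻¹)⁻¹ := by group
    rw [e]; exact inv_mem hx

/-- **`HK^k(G_•)` normalises `HK^k(G_•^{+1})`** inside `G^{{0,1}^k}`.
[cite: GreenTao2010, App. E, Lemma E.5] -/
theorem conj_mem_shift {G_ : ℕ → Subgroup G} (hG : IsFiltration G_) {a d : Vertex k → G}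
    (ha : a ∈ HK k G_) (hd : d ∈ HK k (shift G_)) : a * d * a⁻¹ ∈ HK k (shift G_) := by
  suffices H : ∀ d ∈ HK k (shift G_),
      a * d * a⁻¹ ∈ HK k (shift G_) ∧ a⁻¹ * d * a ∈ HK k (shift G_) from (H d hd).1
  induction ha using Subgroup.closure_induction with
  | mem x hx =>
    obtain ⟨σ, g, hg, rfl⟩ := hx
    intro d hd
    refine ⟨faceElt_conj_mem_shift hG σ hg hd, ?_⟩
    have := faceElt_conj_mem_shift hG σ (inv_mem hg) hd
    rw [faceElt_inv, inv_inv] at this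
    rwa [faceElt_inv]
  | one => intro d hd; simpa using hd
  | mul x y _ _ hx hy =>
    intro d hd
    constructor
    · have e : x * y * d * (x * y)⁻¹ = x * (y * d * y⁻¹) * x⁻¹ := by group
      rw [e]; exact (hx _ (hy d hd).1).1
    · have e : (x * y)⁻¹ * d * (x * y) = y⁻¹ * (x⁻¹ * d * x) * y := by group
      rw [e]; exact (hy _ (hx d hd).2).2
  | inv x _ hx =>
    intro d hd
    constructor
    · simpa using (hx d hd).2
    · simpa using (hx d hd).1

/-! ### Splitting the cube along its first coordinate: `HK^{k+1}` from `HK^k` -/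

/-- The lower half `ω_0 = 0` of a configuration on `{0,1}^{k+1}`, a configuration on `{0,1}^k`.
[folklore] -/
def lowerHalf (c : Vertex (k + 1) → G) : Vertex k → G := fun ω => c (Fin.cons false ω)

/-- The upper half `ω_0 = 1` of a configuration on `{0,1}^{k+1}`. [folklore] -/
def upperHalf (c : Vertex (k + 1) → G) : Vertex k → G := fun ω => c (Fin.cons true ω)

omit [Group G] in
/-- The lower half, evaluated. [folklore] -/
@[simp] theorem lowerHalf_apply (c : Vertex (k + 1) → G) (ω : Vertex k) :
    lowerHalf c ω = c (Fin.cons false ω) := rfl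

omit [Group G] in
/-- The upper half, evaluated. [folklore] -/
@[simp] theorem upperHalf_apply (c : Vertex (k + 1) → G) (ω : Vertex k) :
    upperHalf c ω = c (Fin.cons true ω) := rfl

/-- The lower half of `1` is `1`. [folklore] -/
@[simp] theorem lowerHalf_one : lowerHalf (1 : Vertex (k + 1) → G) = 1 := rfl

/-- The upper half of `1` is `1`. [folklore] -/
@[simp] theorem upperHalf_one : upperHalf (1 : Vertex (k + 1) → G) = 1 := rfl

/-- The lower half is multiplicative. [folklore] -/
theorem lowerHalf_mul (c c' : Vertex (k + 1) → G) :
    lowerHalf (c * c') = lowerHalf c * lowerHalf c' := rfl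

/-- The upper half is multiplicative. [folklore] -/
theorem upperHalf_mul (c c' : Vertex (k + 1) → G) :
    upperHalf (c * c') = upperHalf c * upperHalf c' := rfl

/-- The lower half of an inverse. [folklore] -/
theorem lowerHalf_inv (c : Vertex (k + 1) → G) : lowerHalf c⁻¹ = (lowerHalf c)⁻¹ := rfl

/-- The upper half of an inverse. [folklore] -/
theorem upperHalf_inv (c : Vertex (k + 1) → G) : upperHalf c⁻¹ = (upperHalf c)⁻¹ := rfl

/-- Doubling a configuration on `{0,1}^k` to one on `{0,1}^{k+1}` constant in `ω_0` (the
homomorphism `Γ_F ↦ Γ_{F × {0,1}}` on generators). [folklore] -/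
def doubleHom (k : ℕ) : (Vertex k → G) →* (Vertex (k + 1) → G) where
  toFun a := fun ω => a (Fin.tail ω)
  map_one' := rfl
  map_mul' _ _ := rfl

/-- Placing a configuration on the upper half `ω_0 = 1`, the identity on the lower half (the
homomorphism `Γ_F ↦ Γ_{F × {1}}` on generators). [folklore] -/
def upperHom (k : ℕ) : (Vertex k → G) →* (Vertex (k + 1) → G) where
  toFun d := fun ω => if ω 0 = true then d (Fin.tail ω) else 1
  map_one' := by funext ω; simp
  map_mul' x y := by funext ω; simp only [Pi.mul_apply]; split_ifs <;> simp

/-- `doubleHom`, evaluated. [folklore] -/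
theorem doubleHom_apply (a : Vertex k → G) (ω : Vertex (k + 1)) :
    doubleHom k a ω = a (Fin.tail ω) := rfl

/-- `upperHom`, evaluated. [folklore] -/
theorem upperHom_apply (d : Vertex k → G) (ω : Vertex (k + 1)) :
    upperHom k d ω = if ω 0 = true then d (Fin.tail ω) else 1 := rfl

/-- Doubling a face element gives the face element of `F × {0,1}` (same codimension).
[folklore] -/
theorem doubleHom_faceElt (σ : Face k) (g : G) :
    doubleHom k (faceElt σ g) = faceElt (Fin.cons none σ) g := by
  funext ω
  simp only [doubleHom_apply, faceElt, Face.mem_cons_iff, true_or, true_and]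

/-- Placing a face element on the upper half gives the face element of `F × {1}` (codimension
one more). [folklore] -/
theorem upperHom_faceElt (σ : Face k) (g : G) :
    upperHom k (faceElt σ g) = faceElt (Fin.cons (some true) σ) g := by
  funext ω
  simp only [upperHom_apply, faceElt, Face.mem_cons_iff, reduceCtorEq, Option.some.injEq,
    false_or]
  by_cases h0 : ω 0 = true <;> simp [h0]

/-- The lower half of a face element of `{0,1}^{k+1}`. [folklore] -/
theorem lowerHalf_faceElt_cons (τ : Option Bool) (σ : Face k) (g : G) :
    lowerHalf (faceElt (Fin.cons τ σ : Face (k + 1)) g) =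
      if τ = none ∨ τ = some false then faceElt σ g else 1 := by
  funext ω
  by_cases h1 : (τ = none ∨ τ = some false) <;> by_cases h2 : σ.Mem ω <;>
    simp [faceElt, Face.mem_cons_iff, h1, h2]

/-- The upper half of a face element of `{0,1}^{k+1}`. [folklore] -/
theorem upperHalf_faceElt_cons (τ : Option Bool) (σ : Face k) (g : G) :
    upperHalf (faceElt (Fin.cons τ σ : Face (k + 1)) g) =
      if τ = none ∨ τ = some true then faceElt σ g else 1 := by
  funext ω
  by_cases h1 : (τ = none ∨ τ = some true) <;> by_cases h2 : σ.Mem ω <;>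
    simp [faceElt, Face.mem_cons_iff, h1, h2]

/-- Reassembling a configuration from its lower half and its derivative:
`c = double(c₀) · upper(c₀⁻¹ c₁)`. [folklore] -/
theorem doubleHom_mul_upperHom_eq (c : Vertex (k + 1) → G) :
    doubleHom k (lowerHalf c) * upperHom k ((lowerHalf c)⁻¹ * upperHalf c) = c := by
  funext ω
  have hω : Fin.cons (ω 0) (Fin.tail ω) = ω := Fin.cons_self_tail ω
  simp only [Pi.mul_apply, doubleHom_apply, upperHom_apply, Pi.inv_apply, lowerHalf_apply,
    upperHalf_apply]
  cases h0 : ω 0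
  · simp only [Bool.false_eq_true, if_false, mul_one]
    rw [← h0, hω]
  · simp only [if_true, mul_inv_cancel_left]
    rw [← h0, hω]

/-- `HK^k(G_•)` doubles into `HK^{k+1}(G_•)`. [cite: GreenTao2010, App. E, Def. E.3] -/
theorem doubleHom_mem {G_ : ℕ → Subgroup G} {a : Vertex k → G} (ha : a ∈ HK k G_) :
    doubleHom k a ∈ HK (k + 1) G_ := by
  have : HK k G_ ≤ (HK (k + 1) G_).comap (doubleHom k) := by
    refine (Subgroup.closure_le _).mpr ?_
    rintro _ ⟨σ, g, hg, rfl⟩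
    change doubleHom k (faceElt σ g) ∈ HK (k + 1) G_
    rw [doubleHom_faceElt]
    exact faceElt_mem_HK _ (by simpa [Face.codim_cons] using hg)
  exact this ha

/-- `HK^k(G_•^{+1})` placed on the upper half lies in `HK^{k+1}(G_•)`.
[cite: GreenTao2010, App. E, Def. E.3] -/
theorem upperHom_mem {G_ : ℕ → Subgroup G} {d : Vertex k → G} (hd : d ∈ HK k (shift G_)) :
    upperHom k d ∈ HK (k + 1) G_ := by
  have : HK k (shift G_) ≤ (HK (k + 1) G_).comap (upperHom k) := by
    refine (Subgroup.closure_le _).mpr ?_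
    rintro _ ⟨σ, g, hg, rfl⟩
    change upperHom k (faceElt σ g) ∈ HK (k + 1) G_
    rw [upperHom_faceElt]
    refine faceElt_mem_HK _ ?_
    simp only [shift_apply] at hg
    simpa [Face.codim_cons, add_comm] using hg
  exact this hd

/-- The halves of an element of `HK^{k+1}(G_•)`: the lower half lies in `HK^k(G_•)` and the
derivative `(lower)⁻¹ · upper` in `HK^k(G_•^{+1})` (closure induction; products use
`conj_mem_shift`). [cite: GreenTao2010, App. E, Def. E.3 and Lemma E.5] -/
theorem lowerHalf_mem {G_ : ℕ → Subgroup G} (hG : IsFiltration G_) {c : Vertex (k + 1) → G}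
    (hc : c ∈ HK (k + 1) G_) :
    lowerHalf c ∈ HK k G_ ∧ (lowerHalf c)⁻¹ * upperHalf c ∈ HK k (shift G_) := by
  induction hc using Subgroup.closure_induction with
  | mem x hx =>
    obtain ⟨σ, g, hg, rfl⟩ := hx
    obtain ⟨τ, σ', rfl⟩ : ∃ τ σ', σ = Fin.cons τ σ' :=
      ⟨σ 0, Fin.tail σ, (Fin.cons_self_tail σ).symm⟩
    rw [Face.codim_cons] at hg
    rw [lowerHalf_faceElt_cons, upperHalf_faceElt_cons]
    rcases τ with _ | _ | _
    · simp only [true_or, if_true, zero_add] at hg ⊢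
      exact ⟨faceElt_mem_HK _ hg, by simp⟩
    · simp only [reduceCtorEq, Option.some.injEq, or_true, if_true, Bool.false_eq_true, or_false,
        if_false, mul_one] at hg ⊢
      refine ⟨faceElt_mem_HK _ (hG.antitone (by omega) hg), ?_⟩
      rw [faceElt_inv]
      refine faceElt_mem_HK _ ?_
      rw [shift_apply, add_comm]
      exact inv_mem hg
    · simp only [reduceCtorEq, Option.some.injEq, Bool.true_eq_false, or_false, if_false,
        or_true, if_true, inv_one, one_mul] at hg ⊢
      refine ⟨one_mem _, faceElt_mem_HK _ ?_⟩
      simpa [shift_apply, add_comm] using hg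
  | one =>
    rw [lowerHalf_one, upperHalf_one, inv_one, one_mul]
    exact ⟨one_mem _, one_mem _⟩
  | mul x y _ _ hx hy =>
    refine ⟨mul_mem hx.1 hy.1, ?_⟩
    have e : (lowerHalf (x * y))⁻¹ * upperHalf (x * y) =
        ((lowerHalf y)⁻¹ * ((lowerHalf x)⁻¹ * upperHalf x) * (lowerHalf y)⁻¹⁻¹) *
          ((lowerHalf y)⁻¹ * upperHalf y) := by
      change (lowerHalf x * lowerHalf y)⁻¹ * (upperHalf x * upperHalf y) = _
      group
    rw [e]
    exact mul_mem (conj_mem_shift hG (inv_mem hy.1) hx.2) hy.2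
  | inv x _ hx =>
    refine ⟨inv_mem hx.1, ?_⟩
    have e : (lowerHalf x⁻¹)⁻¹ * upperHalf x⁻¹ =
        lowerHalf x * ((lowerHalf x)⁻¹ * upperHalf x)⁻¹ * (lowerHalf x)⁻¹ := by
      change (lowerHalf x)⁻¹⁻¹ * (upperHalf x)⁻¹ = _
      group
    rw [e]
    exact conj_mem_shift hG hx.1 (inv_mem hx.2)

/-- **Recursive structure of the Host–Kra cube groups**: `c ∈ HK^{k+1}(G_•)` iff its lower half
`c|_{ω_0 = 0}` lies in `HK^k(G_•)` and its derivative `(c|_{ω_0=0})⁻¹ c|_{ω_0=1}` lies in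
`HK^k(G_•^{+1})`; equivalently `HK^{k+1}(G_•) = {(c, c·d) : c ∈ HK^k(G_•), d ∈ HK^k(G_•^{+1})}`.
(The substitute, in this formalisation, for the ordered factorisation (E.1) of the paper.)
[cite: GreenTao2010, App. E, (E.1)] -/
theorem mem_HK_succ_iff {G_ : ℕ → Subgroup G} (hG : IsFiltration G_) (c : Vertex (k + 1) → G) :
    c ∈ HK (k + 1) G_ ↔
      lowerHalf c ∈ HK k G_ ∧ (lowerHalf c)⁻¹ * upperHalf c ∈ HK k (shift G_) := by
  refine ⟨lowerHalf_mem hG, fun h => ?_⟩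
  rw [← doubleHom_mul_upperHom_eq c]
  exact mul_mem (doubleHom_mem h.1) (upperHom_mem h.2)

/-! ### Parallelepipeds are Host–Kra cubes (Lemma E.4) -/

/-- "`ω · h := ω_1 h_1 + ⋯ + ω_{s+1} h_{s+1}`". [cite: GreenTao2010, Def. 11.4] -/
def dot (ω : Vertex k) (h : Fin k → ℤ) : ℤ := ∑ i, bif ω i then h i else 0

omit [Group G] in
/-- `ω · h` split along the first coordinate. [folklore] -/
theorem dot_cons (b : Bool) (ω : Vertex k) (h : Fin (k + 1) → ℤ) :
    dot (Fin.cons b ω : Vertex (k + 1)) h = (bif b then h 0 else 0) + dot ω (Fin.tail h) := by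
  simp only [dot, Fin.sum_univ_succ, Fin.cons_zero, Fin.cons_succ]
  rfl

/-- The constant configuration `x^{{0,1}^k}`, `x ∈ G_0`, lies in `HK^k(G_•)` (the face of
codimension `0`). [cite: GreenTao2010, App. E, Def. E.3] -/
theorem const_mem_HK {G_ : ℕ → Subgroup G} {x : G} (hx : x ∈ G_ 0) :
    (fun _ : Vertex k => x) ∈ HK k G_ := by
  have e : (fun _ : Vertex k => x) = faceElt (fun _ => none) x := by
    funext ω
    rw [faceElt_apply, if_pos (show Face.Mem (fun _ => none) ω from fun i => Or.inl rfl)]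
  rw [e]
  refine faceElt_mem_HK _ ?_
  simpa [Face.codim] using hx

/-- **Parallelepipeds are Host–Kra cubes**: "Given any `g, x ∈ G` and `n, h_1, …, h_{s+1}` in
`ℤ`, the parallelepiped `(g^{n + ω·h} x)_{ω ∈ {0,1}^{s+1}}` lies in `HK^{s+1}(G_•)`" — for a
general filtration, `g ∈ G_1` and `x ∈ G_0` (by induction on the dimension through
`mem_HK_succ_iff`: the derivative of a parallelepiped is the constant `x⁻¹ g^{h_1} x ∈ G_1`).
[cite: GreenTao2010, App. E, Lemma E.4] -/
theorem parallelepiped_mem_HK {G_ : ℕ → Subgroup G} (hG : IsFiltration G_) {g x : G}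
    (hg : g ∈ G_ 1) (hx : x ∈ G_ 0) :
    ∀ (n : ℤ) (h : Fin k → ℤ), (fun ω : Vertex k => g ^ (n + dot ω h) * x) ∈ HK k G_ := by
  induction k with
  | zero =>
    intro n h
    have e : (fun ω : Vertex 0 => g ^ (n + dot ω h) * x) = fun _ => g ^ n * x := by
      funext ω; simp [dot]
    rw [e]
    exact const_mem_HK (mul_mem (zpow_mem (hG.antitone zero_le_one hg) n) hx)
  | succ k ih =>
    intro n h
    rw [mem_HK_succ_iff hG]
    have hl : lowerHalf (fun ω : Vertex (k + 1) => g ^ (n + dot ω h) * x) =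
        fun ω => g ^ (n + dot ω (Fin.tail h)) * x := by
      funext ω; simp [dot_cons]
    have hu : upperHalf (fun ω : Vertex (k + 1) => g ^ (n + dot ω h) * x) =
        fun ω => g ^ ((n + h 0) + dot ω (Fin.tail h)) * x := by
      funext ω; simp [dot_cons, add_assoc]
    rw [hl, hu]
    refine ⟨ih n (Fin.tail h), ?_⟩
    have e : (fun ω : Vertex k => g ^ (n + dot ω (Fin.tail h)) * x)⁻¹ *
        (fun ω => g ^ ((n + h 0) + dot ω (Fin.tail h)) * x) = fun _ => x⁻¹ * g ^ (h 0) * x := by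
      funext ω
      simp only [Pi.mul_apply, Pi.inv_apply, mul_inv_rev]
      rw [show n + h 0 + dot ω (Fin.tail h) = (n + dot ω (Fin.tail h)) + h 0 by ring, zpow_add]
      group
    rw [e]
    refine const_mem_HK ?_
    rw [shift_apply, zero_add]
    simpa using hG.conj_mem (inv_mem hx) (zpow_mem hg (h 0))

/-! ### The corner constraint (Lemma E.7) -/

/-- `HK^0(G_•)` is trivial when `G_0` is. [folklore] -/
theorem HK_zero_eq_bot {G_ : ℕ → Subgroup G} (h0 : G_ 0 = ⊥) : HK 0 G_ = ⊥ := by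
  rw [HK, Subgroup.closure_eq_bot_iff]
  rintro _ ⟨σ, g, hg, rfl⟩
  rw [Face.codim_zero, h0, Subgroup.mem_bot] at hg
  simp [hg]

omit [Group G] in
/-- `1^{k+1} = (1, 1^k)`. [folklore] -/
theorem top_eq_cons : (fun _ : Fin (k + 1) => true) = Fin.cons true (fun _ : Fin k => true) := by
  funext i; refine Fin.cases ?_ (fun j => ?_) i <;> simp

omit [Group G] in
/-- `(0, ω) ≠ 1^{k+1}`. [folklore] -/
theorem cons_false_ne_top (ω : Vertex k) : (Fin.cons false ω : Vertex (k + 1)) ≠ fun _ => true := by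
  intro hh; have := congr_fun hh 0; simp at this

omit [Group G] in
/-- `(1, ω) ≠ 1^{k+1}` for `ω ≠ 1^k`. [folklore] -/
theorem cons_true_ne_top {ω : Vertex k} (hω : ω ≠ fun _ => true) :
    (Fin.cons true ω : Vertex (k + 1)) ≠ fun _ => true := by
  intro hh; apply hω; funext i; simpa using congr_fun hh i.succ

/-- **The corner constraint at `1^k`**: if `G_k = {1}`, `Γ ≤ G` is any subgroup and all vertices
of `c ∈ HK^k(G_•)` other than `1^k` lie in `Γ`, then so does the vertex at `1^k` (induction on `k`
through `mem_HK_succ_iff`: the derivative lies in `HK^{k-1}` of the shifted filtration, whose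
`(k-1)`-st group is `G_k = {1}`). [cite: GreenTao2010, App. E, Lemma E.7] -/
theorem apply_top_mem {G_ : ℕ → Subgroup G} (hG : IsFiltration G_) (hk : G_ k = ⊥)
    (Γ : Subgroup G) {c : Vertex k → G} (hc : c ∈ HK k G_)
    (h : ∀ ω, ω ≠ (fun _ => true) → c ω ∈ Γ) : c (fun _ => true) ∈ Γ := by
  induction k generalizing G_ with
  | zero =>
    rw [HK_zero_eq_bot hk, Subgroup.mem_bot] at hc
    rw [hc, Pi.one_apply]
    exact one_mem Γ
  | succ k ih =>
    obtain ⟨-, h2⟩ := lowerHalf_mem hG hc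
    have key := ih hG.shift hk h2 fun ω hω => by
      simp only [Pi.mul_apply, Pi.inv_apply, lowerHalf_apply, upperHalf_apply]
      exact mul_mem (inv_mem (h _ (cons_false_ne_top ω))) (h _ (cons_true_ne_top hω))
    have e : c (fun _ => true) =
        c (Fin.cons false fun _ => true) * ((lowerHalf c)⁻¹ * upperHalf c) fun _ => true := by
      simp only [Pi.mul_apply, Pi.inv_apply, lowerHalf_apply, upperHalf_apply, ← top_eq_cons,
        mul_inv_cancel_left]
    rw [e]
    exact mul_mem (h _ (cons_false_ne_top _)) key

/-- **Uniqueness of the corner `1^k`**: two elements of `HK^k(G_•)`, `G_k = {1}`, agreeing at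
every other vertex are equal ("`g_{0^{s+1}}` is a word in the `g_ω`, `ω ∈ {0,1}^{s+1}_*`", in its
reflected form). [cite: GreenTao2010, App. E, paragraph before Lemma E.7] -/
theorem eq_of_forall_ne_top_eq {G_ : ℕ → Subgroup G} (hG : IsFiltration G_) (hk : G_ k = ⊥)
    {c c' : Vertex k → G} (hc : c ∈ HK k G_) (hc' : c' ∈ HK k G_)
    (h : ∀ ω, ω ≠ (fun _ => true) → c ω = c' ω) : c = c' := by
  have hd : (c⁻¹ * c') (fun _ => true) ∈ (⊥ : Subgroup G) :=
    apply_top_mem hG hk ⊥ (mul_mem (inv_mem hc) hc') fun ω hω => by simp [h ω hω]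
  rw [Subgroup.mem_bot, Pi.mul_apply, Pi.inv_apply, inv_mul_eq_one] at hd
  funext ω
  by_cases hω : ω = fun _ => true
  · rw [hω]; exact hd
  · exact h ω hω

/-! ### The reflection `ω ↦ 1^k - ω` and the corner `0^k` -/

/-- Reflecting configurations through the centre of the cube, `(Rc)_ω = c_{1-ω}`, a group
automorphism of `G^{{0,1}^k}`. [folklore] -/
def reflect (k : ℕ) : (Vertex k → G) ≃* (Vertex k → G) where
  toFun c := fun ω => c fun i => !ω i
  invFun c := fun ω => c fun i => !ω i
  left_inv c := by funext ω; simp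
  right_inv c := by funext ω; simp
  map_mul' _ _ := rfl

/-- The reflection, evaluated. [folklore] -/
theorem reflect_apply (c : Vertex k → G) (ω : Vertex k) : reflect k c ω = c fun i => !ω i := rfl

/-- The reflection is an involution. [folklore] -/
theorem reflect_reflect (c : Vertex k → G) : reflect k (reflect k c) = c := by
  funext ω; simp [reflect_apply]

/-- The reflection of `g^F` is `g^{F'}` for the reflected face `F'` (fixed values negated).
[folklore] -/
theorem reflect_faceElt (σ : Face k) (g : G) :
    reflect k (faceElt σ g) = faceElt (fun i => (σ i).map (!·)) g := by
  funext ω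
  simp only [reflect_apply, faceElt]
  congr 1
  simp only [Face.Mem, eq_iff_iff]
  refine forall_congr' fun i => ?_
  cases σ i <;> simp

/-- `HK^k(G_•)` is stable under the reflection (faces go to faces of the same codimension).
[folklore] -/
theorem reflect_mem_HK {G_ : ℕ → Subgroup G} {c : Vertex k → G} (hc : c ∈ HK k G_) :
    reflect k c ∈ HK k G_ := by
  have : HK k G_ ≤ (HK k G_).comap (reflect k).toMonoidHom := by
    refine (Subgroup.closure_le _).mpr ?_
    rintro _ ⟨σ, g, hg, rfl⟩
    change reflect k (faceElt σ g) ∈ HK k G_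
    rw [reflect_faceElt]
    exact faceElt_mem_HK _ (by rwa [Face.codim_map_not])
  exact this hc

/-- `Rc ∈ HK^k(G_•) ↔ c ∈ HK^k(G_•)`. [folklore] -/
theorem reflect_mem_HK_iff {G_ : ℕ → Subgroup G} {c : Vertex k → G} :
    reflect k c ∈ HK k G_ ↔ c ∈ HK k G_ :=
  ⟨fun h => by simpa [reflect_reflect] using reflect_mem_HK h, reflect_mem_HK⟩

/-- **The corner constraint at `0^k`** (Lemma E.7 for a general filtration): if `G_k = {1}`,
`Γ ≤ G` is any subgroup and all vertices of `c ∈ HK^k(G_•)` other than `0^k` lie in `Γ`, so does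
the vertex at `0^k`. [cite: GreenTao2010, App. E, Lemma E.7] -/
theorem apply_bot_mem {G_ : ℕ → Subgroup G} (hG : IsFiltration G_) (hk : G_ k = ⊥)
    (Γ : Subgroup G) {c : Vertex k → G} (hc : c ∈ HK k G_)
    (h : ∀ ω, ω ≠ (fun _ => false) → c ω ∈ Γ) : c (fun _ => false) ∈ Γ := by
  have := apply_top_mem hG hk Γ (reflect_mem_HK hc) fun ω hω => by
    rw [reflect_apply]
    refine h _ fun hh => hω ?_
    funext i; simpa using congr_fun hh i
  simpa [reflect_apply] using this

/-- **Uniqueness of the corner `0^k`**: two elements of `HK^k(G_•)`, `G_k = {1}`, agreeing at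
every vertex `ω ≠ 0^k` are equal ("if `G` is `s`-step nilpotent and if
`(g_ω)_{ω ∈ {0,1}^{s+1}} ∈ HK^{s+1}(G_•)` then `g_{0^{s+1}}` is a word in the `g_ω`,
`ω ∈ {0,1}^{s+1}_*`" — the determination, not the word). [cite: GreenTao2010, App. E, paragraph before Lemma E.7] -/
theorem eq_of_forall_ne_bot_eq {G_ : ℕ → Subgroup G} (hG : IsFiltration G_) (hk : G_ k = ⊥)
    {c c' : Vertex k → G} (hc : c ∈ HK k G_) (hc' : c' ∈ HK k G_)
    (h : ∀ ω, ω ≠ (fun _ => false) → c ω = c' ω) : c = c' := by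
  have hd : (c⁻¹ * c') (fun _ => false) ∈ (⊥ : Subgroup G) :=
    apply_bot_mem hG hk ⊥ (mul_mem (inv_mem hc) hc') fun ω hω => by simp [h ω hω]
  rw [Subgroup.mem_bot, Pi.mul_apply, Pi.inv_apply, inv_mul_eq_one] at hd
  funext ω
  by_cases hω : ω = fun _ => false
  · rw [hω]; exact hd
  · exact h ω hω

/-! ### Corollaries: cosets, natural-number parallelepipeds, the lower central series -/

/-- **The corner constraint modulo `Γ`** (the injectivity behind Prop. 11.5: "It follows from
Lemma E.7 that this map is 1-1"): if two cubes of `HK^k(G_•)`, `G_k = {1}`, agree modulo `Γ` at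
every vertex other than `0^k`, they agree modulo `Γ` at `0^k`.
[cite: GreenTao2010, App. E, proof of Prop. 11.5] -/
theorem quotient_apply_bot_eq {G_ : ℕ → Subgroup G} (hG : IsFiltration G_) (hk : G_ k = ⊥)
    (Γ : Subgroup G) {c c' : Vertex k → G} (hc : c ∈ HK k G_) (hc' : c' ∈ HK k G_)
    (h : ∀ ω, ω ≠ (fun _ => false) → (c ω : G ⧸ Γ) = c' ω) :
    (c (fun _ => false) : G ⧸ Γ) = c' (fun _ => false) := by
  rw [QuotientGroup.eq]
  exact apply_bot_mem hG hk Γ (mul_mem (inv_mem hc) hc') fun ω hω => by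
    simpa [QuotientGroup.eq] using h ω hω

/-- The corner constraint modulo `Γ` at the vertex `1^k`.
[cite: GreenTao2010, App. E, proof of Prop. 11.5] -/
theorem quotient_apply_top_eq {G_ : ℕ → Subgroup G} (hG : IsFiltration G_) (hk : G_ k = ⊥)
    (Γ : Subgroup G) {c c' : Vertex k → G} (hc : c ∈ HK k G_) (hc' : c' ∈ HK k G_)
    (h : ∀ ω, ω ≠ (fun _ => true) → (c ω : G ⧸ Γ) = c' ω) :
    (c (fun _ => true) : G ⧸ Γ) = c' (fun _ => true) := by
  rw [QuotientGroup.eq]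
  exact apply_top_mem hG hk Γ (mul_mem (inv_mem hc) hc') fun ω hω => by
    simpa [QuotientGroup.eq] using h ω hω

/-- `ω · h` for `h ∈ ℕ^k`. [cite: GreenTao2010, Def. 11.4] -/
def dotNat (ω : Vertex k) (h : Fin k → ℕ) : ℕ := ∑ i, bif ω i then h i else 0

omit [Group G] in
/-- `ω · h` for natural `h`, cast to `ℤ`. [folklore] -/
theorem dot_natCast (ω : Vertex k) (h : Fin k → ℕ) :
    dot ω (fun i => (h i : ℤ)) = (dotNat ω h : ℤ) := by
  simp only [dot, dotNat, Nat.cast_sum]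
  refine Finset.sum_congr rfl fun i _ => ?_
  cases ω i <;> simp

/-- Parallelepipeds with natural parameters `n ∈ ℕ`, `h ∈ ℕ^k` (those met in orbit averages
`gⁿ x`) lie in `HK^k(G_•)`. [cite: GreenTao2010, App. E, Lemma E.4] -/
theorem parallelepiped_mem_HK_nat {G_ : ℕ → Subgroup G} (hG : IsFiltration G_) {g x : G}
    (hg : g ∈ G_ 1) (hx : x ∈ G_ 0) (n : ℕ) (h : Fin k → ℕ) :
    (fun ω : Vertex k => g ^ (n + dotNat ω h) * x) ∈ HK k G_ := by
  have := parallelepiped_mem_HK hG hg hx n (fun i => (h i : ℤ))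
  simp_rw [dot_natCast] at this
  convert this using 2 with ω
  rw [← zpow_natCast]
  push_cast
  rfl

/-- For an `s`-step nilpotent group (`G_{s+1} = {1}`, i.e. `lowerCentralSeries ⊤ s = ⊥` in
Mathlib's indexing) the filtration `G_•` is trivial at `s + 1`. [cite: GreenTao2010, Def. 8.1] -/
theorem lcs_eq_bot {s : ℕ} (hs : (⊤ : Subgroup G).lowerCentralSeries s = ⊥) : lcs G (s + 1) = ⊥ := by
  rw [lcs_succ, hs]

/-- **Lemma E.7 as printed**: "Suppose that `g = (g_ω)_{ω ∈ {0,1}^{s+1}} ∈ HK^{s+1}(G_•)` and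
that `g_ω ∈ Γ` for all `ω ∈ {0,1}^{s+1}_*`. Then the remaining point `g_{0^{s+1}}` lies in `Γ` as
well." — for an `s`-step nilpotent group `G`, its lower central series `G_•`, and any subgroup
`Γ`. [cite: GreenTao2010, App. E, Lemma E.7] -/
theorem apply_bot_mem_of_nilpotent {s : ℕ} (hs : (⊤ : Subgroup G).lowerCentralSeries s = ⊥)
    (Γ : Subgroup G) {c : Vertex (s + 1) → G} (hc : c ∈ HK (s + 1) (lcs G))
    (h : ∀ ω, ω ≠ (fun _ => false) → c ω ∈ Γ) : c (fun _ => false) ∈ Γ :=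
  apply_bot_mem isFiltration_lcs (lcs_eq_bot hs) Γ hc h

/-- Lemma E.4 as printed: parallelepipeds `(g^{n + ω·h} x)_ω`, `g, x ∈ G`, lie in `HK^k(G_•)` for
the lower central series of any group. [cite: GreenTao2010, App. E, Lemma E.4] -/
theorem parallelepiped_mem_HK_lcs (g x : G) (n : ℤ) (h : Fin k → ℤ) :
    (fun ω : Vertex k => g ^ (n + dot ω h) * x) ∈ HK k (lcs G) :=
  parallelepiped_mem_HK isFiltration_lcs (by simp [lcs_one]) (by simp [lcs_zero]) n h

end Literature.NumberTheory.Sieve.HostKra
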